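import Summits.BirchSwinnertonDyer.BirchSwinnertonDyer.Theorems.AdditiveBranchIMCGordTwoRankOneVisibility
import HarnessLib

/-!
# Crux `GordTwoRankOne` (item 19358): the rank-ONE visibility door, CERTIFICATE SHAPE without twist models
# (options (a) "a `p`-th root of the witness in `E'(ℚ_w)`" / (b) "`w ∤ p`, `E'(ℚ_w)[p] = 0`" only; CELL-FREE)

Cell `bsd-addord`, seat `bsd-addord-k1-c3` (D-0074 row B2), gen 7; sibling of
`AdditiveBranchIMCGordTwoRankOneVisibility.lean` (§1–§3). HONEST FRAMING: nothing here proves the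
Birch–Swinnerton-Dyer conjecture or the crux; THEOREMS ONLY (no definition, no named fact, no `sorry`);
per-pair inputs are displayed binders decided OUTSIDE this file; nothing is booked by this file.

## Why a second shape

The §3 doors carry the partner's twist model `C' • V'^{(p*)} = W'` (`V'` good at `p`) so that the place `p`
is FREE by Mazur–Rubin 2015 (option (vi)). The partner search for the 12 content-window keys of the cell
(kit j263293, this gen: 29 mod-`3` congruent partners of rank 2 / 3 for 10 of the 12 keys, ten of them at
the SAME level `N' = N` — Cremona–Mazur's original situation) shows that on most partners the `(-3)`-twist
is NOT good at `3`: option (vi) is unavailable and the place `3` must be paid by option (a), witnesses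
`3`-divisible in `E'(ℚ₃)`. With a rank-3 partner this is affordable: the localisation
`E'(ℚ)/3 → E'(ℚ₃)/3E'(ℚ₃)` has kernel of dimension `≥ 3 − 1 − dim E'(ℚ₃)[3]`. The doors below drop the
twist model and the Mazur–Rubin binder: pure Cremona–Mazur visibility (n1011's criteria (a)/(b)) + GZK +
Cassels–Tate. They are CELL-FREE — any `E/ℚ` of analytic rank one with `E[p]` irreducible — so they also
serve the rank-one content rows of the (M) and (G-ord, `e ≥ 3`) cruxes 19359 / 19360.

* §4a `exists_sha_ne_zero_of_congr_of_two_witnesses_locallyDivisible` (any number field `K`, odd `p`).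
* §4b `exists_sha_ne_zero_rankOne_irr_of_twoWitnesses_locallyDivisible`,
  `missingLowerBoundAt_rankOne_irr_of_twoWitnesses_locallyDivisible` (over `ℚ`; binders `hCT hGZK` only).

References: Cremona–Mazur 2000 §3 [CremonaMazur2000]; Agashe–Stein 2002 Lemma 3.6 [AgasheStein2002];
Silverman AEC X.4.14 [SilvermanAEC2009]; Gross 1991 §2 [GrossLMS1991].
-/

set_option autoImplicit false

noncomputable section

open scoped Classical

open WeierstrassCurve Literature.NumberTheory.EllipticCurves
  Literature.NumberTheory.EllipticCurves.Rank1Residual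
  Literature.NumberTheory.EllipticCurves.Rank1Residual.Typed
  Literature.NumberTheory.GaloisRepresentations
  Summit.BirchSwinnertonDyer.Rank1Residual.GaloisImage
open NumberField IsDedekindDomain Rat.HeightOneSpectrum Field

set_option linter.dupNamespace false

namespace Summit.BirchSwinnertonDyer.BirchSwinnertonDyer.Theorems.AdditiveBranchIMCGordTwoRankOneVisibility

/-! ## §4 The certificate shape WITHOUT twist models: options (a)/(b) only — any cell -/

section CertificateShape

variable {K : Type} [Field K] [NumberField K] (W W' : WeierstrassCurve K) [W.IsElliptic]
  [W'.IsElliptic] {p : ℕ} [hp : Fact p.Prime]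

/-- **Two-witness visibility, certificate shape (any number field `K`, odd `p`).** As
`exists_sha_ne_zero_of_congr_of_two_witnesses`, the local condition at each `v ∈ S` being supplied, for
EACH witness, by EITHER (a) a `p`-th root of `P_i` in `E'(K_v)` (any reduction, `v ∣ p` allowed) OR (b)
`v ∤ p` and `E'(K_v)[p] = 0`. Cyclicity of `E(K)/pE(K)` in the generator form. The rank-one twin of
n1011's `VisibleWitness.exists_sha_ne_zero_of_congr_of_locallyDivisible`.
[cite: CremonaMazur2000, §3] [cite: AgasheStein2002, Lemma 3.6] -/
theorem exists_sha_ne_zero_of_congr_of_two_witnesses_locallyDivisible (hp2 : p ≠ 2)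
    (θ : geomTorsion W' (p : ℤ) ≃+ geomTorsion W (p : ℤ))
    (hθ : ∀ (σ : absoluteGaloisGroup K) (P : geomTorsion W' (p : ℤ)), θ (σ • P) = σ • θ P)
    (S : Finset (HeightOneSpectrum (𝓞 K)))
    (hS : ∀ v : HeightOneSpectrum (𝓞 K), v ∉ S →
      W.HasGoodReductionAt v ∧ W'.HasGoodReductionAt v ∧ (p : 𝓞 K) ∉ v.asIdeal)
    (hE : ∃ G : W.toAffine.Point, ∀ Q : W.toAffine.Point,
      ∃ (a : ℤ) (R : W.toAffine.Point), Q = a • G + (p : ℤ) • R)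
    (P₁ P₂ : W'.toAffine.Point)
    (hind : ∀ a b : ℤ, a • P₁ + b • P₂ ∈
      (zsmulAddGroupHom (p : ℤ) : W'.toAffine.Point →+ W'.toAffine.Point).range →
      (p : ℤ) ∣ a ∧ (p : ℤ) ∣ b)
    (hdiv : ∀ P ∈ [P₁, P₂], ∀ v ∈ S,
      (∃ Q : (W'.baseChange (v.adicCompletion K)).toAffine.Point,
        p • Q = WeierstrassCurve.Affine.Point.baseChange (W' := W') K (v.adicCompletion K) P) ∨
      ((p : 𝓞 K) ∉ v.asIdeal ∧ Nat.card (nsmulAddMonoidHom p :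
        (W'.baseChange (v.adicCompletion K)).toAffine.Point →+ _).ker = 1)) :
    ∃ c : W.sha, c ≠ 0 ∧ p • c = 0 := by
  have hpp : p.Prime := Fact.out
  have hn : (p : ℤ) ≠ 0 := by exact_mod_cast hpp.ne_zero
  have hdiv' : ∀ P : geomPoints W', ∃ Q : geomPoints W', (p : ℤ) • Q = P :=
    W'.zsmul_geomPoints_surjective_holds hn
  -- per-place dispatch, verbatim from n1011's certificate shape
  have hloc : ∀ P ∈ [P₁, P₂], ∀ v ∈ S, h1Equiv θ hθ (kummerMapTorsion W' (p : ℤ) hdiv' P) ∈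
      selmerLocalKer W (v.adicCompletion K) (p : ℤ) := by
    intro P hP v hv
    rcases hdiv P hP v hv with ⟨Q, hQ⟩ | ⟨hpv, hcard⟩
    · exact VisibleWitness.h1Equiv_kummerMapTorsion_mem_selmerLocalKer_of_exists_smul_eq W W' θ hθ
        (v.adicCompletion K) hn hdiv' P ⟨Q, by rw [natCast_zsmul]; exact hQ⟩
    · refine VisibleWitness.h1Equiv_kummerMapTorsion_mem_selmerLocalKer_of_natCard_eq_one W W' θ hθ
        (v.adicCompletion K) hdiv' P ?_
      rw [W'.natCard_kummerLocalConditionAt_adicCompletion v hpp.ne_zero, hcard, one_mul,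
        natCard_quot_adicCompletionIntegers_eq_one hpv]
  exact exists_sha_ne_zero_of_congr_of_two_witnesses W W' hp2 θ hθ S hS hdiv' hE P₁ P₂ hind
    (hloc P₁ (by simp)) (hloc P₂ (by simp))

end CertificateShape

section CellFreeDoors

variable {W : WeierstrassCurve ℚ} [W.IsElliptic] [W.IsGloballyMinimal] {p : ℕ} [hp : Fact p.Prime]

omit [W.IsGloballyMinimal] in
/-- **`Ш(E)[p] ≠ 0` by two-witness visibility, CELL-FREE certificate shape** (`E/ℚ` of analytic rank one
with `E[p]` irreducible, `p` odd): GZK + irreducibility give the cyclicity of `E(ℚ)/pE(ℚ)`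
(`exists_generator_rankOne_of_irr`); the per-pair data are `θ`, `S`, two witnesses independent mod `p`,
and at each place of `S`, for each witness, option (a) (a `p`-th root in `E'(ℚ_w)`, `w = p` allowed) or
(b) (`w ≠ p`, `E'(ℚ_w)[p] = 0`). NO twist model, NO Mazur–Rubin binder, NO cell binder. Per pair.
[cite: CremonaMazur2000, §3] [cite: AgasheStein2002, Lemma 3.6] -/
theorem exists_sha_ne_zero_rankOne_irr_of_twoWitnesses_locallyDivisible
    (hGZK : rank_eq_analyticRank_of_analyticRank_le_one) (hp2 : p ≠ 2)
    (hirr : Irr W p) (hr : W.analyticRank = 1)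
    (W' : WeierstrassCurve ℚ) [W'.IsElliptic]
    (θ : geomTorsion W' (p : ℤ) ≃+ geomTorsion W (p : ℤ))
    (hθ : ∀ (σ : absoluteGaloisGroup ℚ) (P : geomTorsion W' (p : ℤ)), θ (σ • P) = σ • θ P)
    (S : Finset (HeightOneSpectrum (𝓞 ℚ)))
    (hS : ∀ w : HeightOneSpectrum (𝓞 ℚ), w ∉ S →
      W.HasGoodReductionAt w ∧ W'.HasGoodReductionAt w ∧ (p : 𝓞 ℚ) ∉ w.asIdeal)
    (P₁ P₂ : W'.toAffine.Point)
    (hind : ∀ a b : ℤ, a • P₁ + b • P₂ ∈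
      (zsmulAddGroupHom (p : ℤ) : W'.toAffine.Point →+ W'.toAffine.Point).range →
      (p : ℤ) ∣ a ∧ (p : ℤ) ∣ b)
    (hdiv : ∀ P ∈ [P₁, P₂], ∀ w ∈ S,
      (∃ Q : (W'.baseChange (w.adicCompletion ℚ)).toAffine.Point,
        p • Q = WeierstrassCurve.Affine.Point.baseChange (W' := W') ℚ (w.adicCompletion ℚ) P) ∨
      ((p : 𝓞 ℚ) ∉ w.asIdeal ∧ Nat.card (nsmulAddMonoidHom p :
        (W'.baseChange (w.adicCompletion ℚ)).toAffine.Point →+ _).ker = 1)) :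
    ∃ c : W.sha, c ≠ 0 ∧ p • c = 0 := by
  obtain ⟨G, hG⟩ := exists_generator_rankOne_of_irr (W := W) (p := p) hGZK hirr hr
  -- §4's general theorem is stated with the classical `DecidableEq`; transport pointwise with `convert`
  refine exists_sha_ne_zero_of_congr_of_two_witnesses_locallyDivisible W W' hp2 θ hθ S hS
    ⟨G, fun Q ↦ ?_⟩ P₁ P₂ (fun a b hab ↦ hind a b (by convert hab)) hdiv
  obtain ⟨a, R, h⟩ := hG Q
  exact ⟨a, R, by convert h⟩

omit [W.IsGloballyMinimal] in
/-- **The LOWER half by two-witness visibility, CELL-FREE certificate shape: the CONTENT-window door for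
ANY rank-one row with `E[p]` irreducible** (`p` odd; datum `#Ш(E)_an = q`, `ord_p q ≤ 2`). Published
inputs: Cassels–Tate (`hCT`), GZK (`hGZK`). Per-pair data: `θ`, `S`, two witnesses of the partner independent
mod `p` with options (a)/(b) at every place of `S`. Chain: visibility ⟹ `Ш(E)[p] ≠ 0` ⟹ Cassels–Tate
squareness ⟹ `ord_p #Ш_an ≤ 2 ≤ ord_p #Ш`. Serves the rank-one content rows of 19358 (and of 19359 /
19360, any cell). Per pair; NOT a class theorem. [cite: CremonaMazur2000, §3] [cite: AgasheStein2002, Lemma 3.6]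
[cite: SilvermanAEC2009, Thm. X.4.14] -/
theorem missingLowerBoundAt_rankOne_irr_of_twoWitnesses_locallyDivisible
    (hCT : exists_casselsTate_pairing (K := ℚ)) (hGZK : rank_eq_analyticRank_of_analyticRank_le_one)
    (hp2 : p ≠ 2) (hirr : Irr W p) (hr : W.analyticRank = 1)
    {q : ℚ} (hq : shaAn W = (q : ℂ)) (hv : padicValRat p q ≤ 2)
    (W' : WeierstrassCurve ℚ) [W'.IsElliptic]
    (θ : geomTorsion W' (p : ℤ) ≃+ geomTorsion W (p : ℤ))
    (hθ : ∀ (σ : absoluteGaloisGroup ℚ) (P : geomTorsion W' (p : ℤ)), θ (σ • P) = σ • θ P)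
    (S : Finset (HeightOneSpectrum (𝓞 ℚ)))
    (hS : ∀ w : HeightOneSpectrum (𝓞 ℚ), w ∉ S →
      W.HasGoodReductionAt w ∧ W'.HasGoodReductionAt w ∧ (p : 𝓞 ℚ) ∉ w.asIdeal)
    (P₁ P₂ : W'.toAffine.Point)
    (hind : ∀ a b : ℤ, a • P₁ + b • P₂ ∈
      (zsmulAddGroupHom (p : ℤ) : W'.toAffine.Point →+ W'.toAffine.Point).range →
      (p : ℤ) ∣ a ∧ (p : ℤ) ∣ b)
    (hdiv : ∀ P ∈ [P₁, P₂], ∀ w ∈ S,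
      (∃ Q : (W'.baseChange (w.adicCompletion ℚ)).toAffine.Point,
        p • Q = WeierstrassCurve.Affine.Point.baseChange (W' := W') ℚ (w.adicCompletion ℚ) P) ∨
      ((p : 𝓞 ℚ) ∉ w.asIdeal ∧ Nat.card (nsmulAddMonoidHom p :
        (W'.baseChange (w.adicCompletion ℚ)).toAffine.Point →+ _).ker = 1)) :
    MissingLowerBoundAt W p := by
  have hex : ∃ c : W.sha, c ≠ 0 ∧ p • c = 0 :=
    exists_sha_ne_zero_rankOne_irr_of_twoWitnesses_locallyDivisible hGZK hp2 hirr hr W' θ hθ S hS P₁ P₂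
      hind hdiv
  have hfinSha : W.ShaFinite := (hGZK W (by rw [hr])).2
  exact missingLowerBoundAt_of_casselsTate_of_pow_dvd W p hCT hfinSha hq (k := 1) (by simpa using hv)
    (by simpa using dvd_shaOrder_of_exists_torsion W p hex)

end CellFreeDoors

end Summit.BirchSwinnertonDyer.BirchSwinnertonDyer.Theorems.AdditiveBranchIMCGordTwoRankOneVisibility

end
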